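import Literature.RingTheory.Flat.NilpotentCriterion
import Mathlib.RingTheory.RingHom.Flat
import Mathlib.Algebra.Category.Ring.Constructions
import Mathlib.RingTheory.Ideal.Maps
import HarnessLib

/-!
# The nilpotent flatness criterion, relative form: flatness over an intermediate ring

Topic `Literature/RingTheory/Flat`; theorems only (no definition, no named fact, no instance).
Matsumura, *Commutative Ring Theory*, §22 Thm. 22.3 (α): for a ring `A`, a NILPOTENT ideal `I`
and an `A`-module `M`, «`M` is flat over `A`» ⇔ «`M/IM` is flat over `A/I` and `I ⊗_A M = IM`».
The tree proves (3) ⇒ (1) for finitely generated `I`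
(`Literature.RingTheory.Flat.flat_of_isNilpotent_of_flat_baseChange`). This file records the
RELATIVE consequence used to study morphisms over an infinitesimal thickening of the base:

* `flat_of_isNilpotent_of_flat_baseChange_map` — let `R → A → B` be ring maps and `J ⊆ R` a
  finitely generated nilpotent ideal; if `B` is flat over `R` and `B/JB = (A/JA) ⊗_A B` is flat over
  `A/JA`, then `B` is flat over `A`. (Thm. 22.3 (α) over the pair `(A, JA)`: the hypothesis
  `Tor₁^A(A/JA, B) = 0`, i.e. `JA ⊗_A B → B` injective, follows from `R`-flatness of `B` because
  `J ⊗_R B → JA ⊗_A B` is surjective — `lTensor_subtype_map_injective_of_flat`.)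
* `flat_of_isPushout_of_isNilpotent_ker` — the same statement in the PUSHOUT currency
  that the scheme-theoretic user (`Literature/AlgebraicGeometry/Morphisms/FlatModuloNilpotent.lean`)
  reads off affine charts: `ρ : R ⟶ R₀` surjective with finitely generated nilpotent kernel,
  `A₀` a pushout of `A ← R → R₀`, `B₀` a pushout of `B ← A → A₀`; if `R → B` and `A₀ → B₀` are
  flat then `A → B` is flat. (Road: `A → A/JA` factors through the pushout `A₀`; base-change the
  flat map `A₀ → B₀` along `A₀ → A/JA` (Mathlib `RingHom.Flat.isStableUnderBaseChange`), paste
  the two pushouts and compare with the pushout `(A/JA) ⊗_A B`.)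

## References
* [Matsumura1987] H. Matsumura, *Commutative Ring Theory*, CSAM 8, §22 Thm. 22.3 (α) (3) ⇒ (1)
  (book p. 174; held text p0190).
* [StacksProject] The Stacks Project, Tag 051C (flatness criteria over Artinian rings) and Tag 00MK
  (local criterion) — context only.
-/

universe u v w

open TensorProduct CategoryTheory CategoryTheory.Limits

namespace Literature.RingTheory.Flat

/-! ## §1 Unbundled form: `R → A → B`, `J ⊆ R` -/

section Algebra

variable {R : Type u} {A : Type v} {B : Type w} [CommRing R] [CommRing A] [CommRing B]
  [Algebra R A] [Algebra R B] [Algebra A B] [IsScalarTower R A B]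

/-- **`Tor₁^A(A/JA, B) = 0` from flatness over the base.** Let `R → A → B` be ring maps and
`J ⊆ R` an ideal. If `B` is flat over `R`, then `B ⊗_A (JA) → B ⊗_A A` is injective: the
composite `B ⊗_R J → B ⊗_A (A ⊗_R J) → B ⊗_A JA → B ⊗_A A ≅ B` is `b ⊗ j ↦ jb`, i.e. the
injective map `B ⊗_R J → B ⊗_R R ≅ B`, and `B ⊗_R J → B ⊗_A JA` is surjective because `JA` is
generated by the image of `J`. (The step «`I ⊗ M = IM`» of Matsumura's Thm. 22.3 (3) for the pair
`(A, JA)`.) [cite: Matsumura1987, §22 Thm. 22.3 (α), condition (3)] -/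
theorem lTensor_subtype_map_injective_of_flat (J : Ideal R) [Module.Flat R B] :
    Function.Injective (LinearMap.lTensor B (J.map (algebraMap R A)).subtype) := by
  classical
  set I : Ideal A := J.map (algebraMap R A) with hIdef
  -- `μ : A ⊗_R J → A`, `a ⊗ j ↦ j • a`, lands in `I = JA`
  let μ : A ⊗[R] ↥J →ₗ[A] A :=
    (AlgebraTensorModule.rid R A A).toLinearMap ∘ₗ (J.subtype.baseChange A)
  have hμ_tmul : ∀ (a : A) (j : ↥J), μ (a ⊗ₜ[R] j) = (j : R) • a := by
    intro a j
    simp [μ, LinearMap.baseChange_tmul]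
  have hμ_mem : ∀ t, μ t ∈ I := by
    intro t
    induction t using TensorProduct.induction_on with
    | zero => rw [map_zero]; exact I.zero_mem
    | tmul a j =>
      rw [hμ_tmul, Algebra.smul_def]
      exact I.mul_mem_right _ (Ideal.mem_map_of_mem _ j.2)
    | add x y hx hy => rw [map_add]; exact I.add_mem hx hy
  let μ' : A ⊗[R] ↥J →ₗ[A] ↥I := LinearMap.codRestrict I μ hμ_mem
  have hμ'_val : ∀ t, (μ' t : A) = μ t := fun t => rfl
  have hμ'_surj : Function.Surjective μ' := by
    have hle : I ≤ LinearMap.range μ := by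
      rw [hIdef, Ideal.map_le_iff_le_comap]
      intro j hj
      exact ⟨(1 : A) ⊗ₜ[R] ⟨j, hj⟩, by rw [hμ_tmul, Algebra.smul_def, mul_one]⟩
    rintro ⟨x, hx⟩
    obtain ⟨t, ht⟩ := hle hx
    exact ⟨t, Subtype.ext (by rw [hμ'_val, ht])⟩
  -- `σ : B ⊗_R J → B ⊗_A JA`, surjective
  let σ : B ⊗[R] ↥J →ₗ[A] B ⊗[A] ↥I :=
    LinearMap.lTensor B μ' ∘ₗ (AlgebraTensorModule.cancelBaseChange R A A B ↥J).symm.toLinearMap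
  have hσ : Function.Surjective σ :=
    (LinearMap.lTensor_surjective B hμ'_surj).comp (LinearEquiv.surjective _)
  -- the composite `B ⊗_R J → B ⊗_A JA → B ⊗_A A ≅ B` is `b ⊗ j ↦ j • b`
  have hcomp : ∀ t : B ⊗[R] ↥J,
      TensorProduct.rid A B (LinearMap.lTensor B I.subtype (σ t)) =
        TensorProduct.rid R B (LinearMap.lTensor B J.subtype t) := by
    intro t
    induction t using TensorProduct.induction_on with
    | zero => simp only [map_zero]
    | tmul b j =>
      simp only [σ, LinearMap.coe_comp, LinearEquiv.coe_coe, Function.comp_apply,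
        AlgebraTensorModule.cancelBaseChange_symm_tmul, LinearMap.lTensor_tmul,
        Submodule.coe_subtype, hμ'_val, hμ_tmul, TensorProduct.rid_tmul, smul_assoc, one_smul]
    | add x y hx hy => simp only [map_add, hx, hy]
  have hinjR : Function.Injective (LinearMap.lTensor B J.subtype) :=
    Module.Flat.lTensor_preserves_injective_linearMap _ J.injective_subtype
  rw [injective_iff_map_eq_zero]
  intro x hx
  obtain ⟨t, rfl⟩ := hσ x
  have h0 : TensorProduct.rid R B (LinearMap.lTensor B J.subtype t) = 0 := by
    rw [← hcomp, hx, map_zero]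
  have ht : t = 0 := hinjR (by rw [map_zero]; exact (LinearEquiv.map_eq_zero_iff _).mp h0)
  rw [ht, map_zero]

omit [Algebra R A] in
/-- A nilpotent ideal extends to a nilpotent ideal. [folklore] -/
private theorem isNilpotent_map_of_isNilpotent {J : Ideal R} (hJ : IsNilpotent J) (f : R →+* A) :
    IsNilpotent (J.map f) := by
  obtain ⟨n, hn⟩ := hJ
  exact ⟨n, by rw [← Ideal.map_pow, hn, Ideal.zero_eq_bot, Ideal.map_bot, Submodule.zero_eq_bot]⟩

/-- **The nilpotent flatness criterion, relative form** (Matsumura Thm. 22.3 (α), (3) ⇒ (1),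
applied over the pair `(A, JA)`). Let `R → A → B` be ring maps and `J ⊆ R` a finitely generated
nilpotent ideal. If `B` is flat over `R` and `(A/JA) ⊗_A B` is flat over `A/JA`, then `B` is flat
over `A`. («(3) `M₀` is flat over `A₀` and `I ⊗_A M = IM` ⇒ (1) `M` is flat over `A`», with
`I := JA` nilpotent and finitely generated, `M := B`; `I ⊗ M = IM` is
`lTensor_subtype_map_injective_of_flat`.) [cite: Matsumura1987, §22 Thm. 22.3 (α), (3) ⇒ (1)] -/
theorem flat_of_isNilpotent_of_flat_baseChange_map {J : Ideal R} (hJ : IsNilpotent J)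
    (hJfg : J.FG) [Module.Flat R B]
    [Module.Flat (A ⧸ J.map (algebraMap R A)) ((A ⧸ J.map (algebraMap R A)) ⊗[A] B)] :
    Module.Flat A B :=
  flat_of_isNilpotent_of_flat_baseChange (R := A) (N := B) (J := J.map (algebraMap R A))
    (isNilpotent_map_of_isNilpotent hJ _) (hJfg.map _) (lTensor_subtype_map_injective_of_flat J)

end Algebra

/-! ## §2 Pushout currency in `CommRingCat` -/

section Pushout

variable {R R₀ A A₀ B B₀ : CommRingCat.{u}}

/-- An isomorphism of `CommRingCat` is a flat ring map. [folklore] -/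
private theorem flat_hom_of_isIso (e : A ⟶ B) [IsIso e] : e.hom.Flat :=
  RingHom.Flat.of_bijective (asIso e).commRingCatIsoToRingEquiv.bijective

/-- **The nilpotent flatness criterion in pushout form.** Let `ρ : R ⟶ R₀` be a surjective ring
map whose kernel is finitely generated and nilpotent, `a : R ⟶ A`, and let
```
R  --a--> A --φ--> B
|ρ        |i       |j
v         v        v
R₀ -a₀--> A₀ -φ₀-> B₀
```
be two PUSHOUT squares (`A₀ = A ⊗_R R₀ = A/JA`, `B₀ = B ⊗_A A₀ = B/JB`, `J = ker ρ`). If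
`R → B` is flat and `φ₀ : A₀ → B₀` is flat, then `φ : A → B` is flat. (Matsumura Thm. 22.3 (α)
(3) ⇒ (1) over `(A, JA)` = `flat_of_isNilpotent_of_flat_baseChange_map`; the translation: the
quotient map `A → A/JA` factors through the pushout `A₀`, the base change of `φ₀` along
`A₀ → A/JA` is flat and is — by pasting of pushouts and uniqueness — the structure map
`A/JA → (A/JA) ⊗_A B`.) [cite: Matsumura1987, §22 Thm. 22.3 (α), (3) ⇒ (1)] -/
theorem flat_of_isPushout_of_isNilpotent_ker {ρ : R ⟶ R₀}
    (hρ : Function.Surjective ρ.hom) (hnil : IsNilpotent (RingHom.ker ρ.hom))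
    (hfg : (RingHom.ker ρ.hom).FG) {a : R ⟶ A} {i : A ⟶ A₀} {a₀ : R₀ ⟶ A₀}
    (hA : IsPushout a ρ i a₀) {φ : A ⟶ B} {j : B ⟶ B₀} {φ₀ : A₀ ⟶ B₀}
    (hB : IsPushout φ i j φ₀) (hRB : (a ≫ φ).hom.Flat) (hφ₀ : φ₀.hom.Flat) : φ.hom.Flat := by
  classical
  -- algebra structures along `R → A → B`
  letI : Algebra R A := a.hom.toAlgebra
  letI : Algebra A B := φ.hom.toAlgebra
  letI : Algebra R B := (a ≫ φ).hom.toAlgebra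
  haveI : IsScalarTower R A B := IsScalarTower.of_algebraMap_eq fun r => rfl
  haveI : Module.Flat R B := hRB
  set J : Ideal R := RingHom.ker ρ.hom with hJdef
  set I : Ideal A := J.map (algebraMap R A) with hIdef
  -- the quotient `A/I` as an object, and the quotient map
  let Q : CommRingCat.{u} := CommRingCat.of (A ⧸ I)
  let mk : A ⟶ Q := CommRingCat.ofHom (algebraMap A (A ⧸ I))
  -- `R → A → A/I` kills `J = ker ρ`, hence factors through `ρ`
  have hker : RingHom.ker ρ.hom ≤ RingHom.ker ((algebraMap A (A ⧸ I)).comp a.hom) := by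
    intro r hr
    rw [RingHom.mem_ker, RingHom.comp_apply, Ideal.Quotient.algebraMap_eq,
      Ideal.Quotient.eq_zero_iff_mem]
    exact Ideal.mem_map_of_mem _ hr
  let ρbar : R₀ ⟶ Q :=
    CommRingCat.ofHom (ρ.hom.liftOfSurjective hρ ⟨(algebraMap A (A ⧸ I)).comp a.hom, hker⟩)
  have hρbar : ρ ≫ ρbar = a ≫ mk := by
    ext r
    change (ρ.hom.liftOfSurjective hρ ⟨(algebraMap A (A ⧸ I)).comp a.hom, hker⟩) (ρ.hom r) =
      algebraMap A (A ⧸ I) (a.hom r)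
    rw [RingHom.liftOfSurjective_comp_apply]
    rfl
  -- the induced map `u : A₀ ⟶ A/I` with `i ≫ u = mk`
  let u : A₀ ⟶ Q := hA.desc mk ρbar hρbar.symm
  have hu : i ≫ u = mk := hA.inl_desc mk ρbar hρbar.symm
  -- base change of `φ₀` along `u`: flat
  let t : IsPushout φ₀ u (pushout.inr u φ₀) (pushout.inl u φ₀) :=
    (IsPushout.of_hasPushout u φ₀).flip
  have hflat_inl : (pushout.inl u φ₀).hom.Flat :=
    RingHom.Flat.isStableUnderBaseChange.pushout_inl RingHom.Flat.respectsIso u φ₀ hφ₀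
  -- paste: a pushout of `B ← A → A/I`
  have hpaste : IsPushout φ mk (j ≫ pushout.inr u φ₀) (pushout.inl u φ₀) := by
    rw [← hu]
    exact hB.paste_vert t
  -- the tensor-product pushout of the same span
  have hT : IsPushout mk φ (CommRingCat.ofHom (Algebra.TensorProduct.includeLeftRingHom))
      (CommRingCat.ofHom (Algebra.TensorProduct.includeRight (R := A) (A := A ⧸ I)
        (B := B)).toRingHom) :=
    CommRingCat.isPushout_tensorProduct A (A ⧸ I) B
  -- uniqueness of pushouts: `includeLeft = inl ≫ (iso)`
  have hcomp : pushout.inl u φ₀ ≫ (hpaste.flip.isoPushout.hom ≫ hT.isoPushout.inv) =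
      CommRingCat.ofHom (Algebra.TensorProduct.includeLeftRingHom) := by
    rw [← Category.assoc, hpaste.flip.inl_isoPushout_hom, hT.inl_isoPushout_inv]
  have hflat_incl : (CommRingCat.ofHom
      (Algebra.TensorProduct.includeLeftRingHom (R := A) (A := A ⧸ I) (B := B))).hom.Flat := by
    rw [← hcomp, CommRingCat.hom_comp]
    exact RingHom.Flat.comp hflat_inl (flat_hom_of_isIso _)
  -- hence `(A/I) ⊗_A B` is flat over `A/I`
  haveI : Module.Flat (A ⧸ I) ((A ⧸ I) ⊗[A] B) := by
    rw [← RingHom.flat_algebraMap_iff]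
    convert hflat_incl using 1
    ext x
    simp [Algebra.TensorProduct.algebraMap_apply]
  -- Matsumura 22.3 (α) over `(A, I)`
  have hflat : Module.Flat A B :=
    flat_of_isNilpotent_of_flat_baseChange_map (R := R) (A := A) (B := B) hnil hfg
  exact hflat

end Pushout

end Literature.RingTheory.Flat
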